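import Literature.MathematicalPhysics.QuantumFieldTheory.Balaban1983to89.B9Eq335UnitaryClassCompactZd
import Literature.MathematicalPhysics.QuantumFieldTheory.Balaban1983to89.B9Thm311PerMemberCubeZdUnconditional
import Literature.MathematicalPhysics.QuantumFieldTheory.Balaban1983to89.B9Thm311ContinuityMethodZd

/-!
# `Balaban1983to89.B9Thm311CoerciveCompactZd` — [Balaban1985BackgroundPropagators] THEOREM 3.11 ∕ [Balaban1984PropagatorsII] p. 226 («the operator Δ_a is bounded
# from below by a positive constant») IN QUANTITATIVE CURRENCY, PER MEMBER, AT THE `ℤᵈ × 𝔸` CARRIER: ONE COERCIVITY CONSTANT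
# `c·⟨A, A⟩_τ ≤ ⟨A, Δ_a(U₀)A⟩_τ` on `E_𝔤(□₀)` FOR EVERY UNITARY BACKGROUND WITH SMALL PLAQUETTE VARIABLES NEAR THE MEMBER — compactness of the unitary class
# (`B9Eq335UnitaryClassCompactZd`) + continuity of the genuine letters (this seat's g3) + dag-n06-b g19's per-member positivity + dag-n06-w3 g3's covariance

statement-level skeleton of published theorems with citation tags; proofs where landed; nothing here is a claim about the
Yang–Mills mass gap

`[Balaban1985BackgroundPropagators]` ("B9", CMP **99** (1985) 389–434) p. 416, Theorem 3.11: *«Under the assumptions of the Theorems 3.1–3.10 (i.e. for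
M sufficiently large and α₀ sufficiently small) the operators Δ′_a, G′, (Q′G′²Q′*)⁻¹, Δ_a, G are positive definite. … Doing the gauge transformation we get
the configuration U = e^{iηA} with A small …»*; p. 418 (3.115).  `[Balaban1984PropagatorsII]` ("[4]", CMP **96**) p. 226: *«the operator Δ_a is bounded from
below by a positive constant, hence … G = Δ_a⁻¹»*.  PDF held: `paper:balaban1985-cmp99-background-propagators` pp. 395–396, 416–418 (re-read 2026-08-28).

CITATION HEADER (lean-in-tree rule).  Cell `pub-ymgap` (YM Track A, HUMAN RULING D-0062 ∕ D-0149 width push), DAG node N06 = [B9], width seat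
`pub-ymgap-dag-n06-w4` (g4), CLAIM-1 ∕ INTENT-1.  Inputs consumed BY NAME, nothing restated: dag-n06-b g19's UNCONDITIONAL per-member road
(`B9Thm311PerMemberCubeZdUnconditional.regularAtH_of_pdevOn_lt_cube`; the schema `B9Thm311GaugeReductionZd.of_pdevOn_lt`; the locality
`B9Eq326DeltaALocalityZd.regular_opsAllZd_congr_cube`), this seat's g3 `B9Thm311PosDefOpenRegimeZd.lettersContinuousWithinAt_opsAllZd_cube_reg17UnivP` and
`B9Thm311PosDefNearFlatZd.bondPair_pos_eventually_one_cube_reg17UnivP`, dag-n06-w2 g3's `B9Eq326DeltaAHermitianZdCurved.linear_herm_on_reg17UnivP` and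
`B9Eq17RegimeBallZd.{ball_subset_reg17UnivP, exists_uniform_ball_of_eventually_reg17UnivP}`, dag-n06-w3 g3's `B9Eq334GaugeCovarianceZd.{bondPair_deltaAOf_gaugeAct,
bondPair_rotB, letterCovAt_deltaAOf_opsAllZd}`, the engine `B9Eq335UnitaryClassCompactZd.exists_coercive_on_of_isCompact` (this seat, g4).  PURPOSE (for the N06
census): the DISPLAYED coercivity input `hcoer` of this seat's g3 `B9Thm311ContinuityMethodZd.bondPair_pos_on_reg17UnivP_of_coercive` and the bond-sector SHAPE
`hco : ∀ Ψ, m·⟨Ψ,Ψ⟩ ≤ ⟨Ψ, Δ_a(U₀)Ψ⟩` of dag-n10-w2's Combes–Thomas junction `B13GreenCentreDecayOfCoercive` — discharged at the `ℤᵈ` carrier, per member, for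
the whole local small-field class at once.

WHAT IS PROVED (kernel, 0 sorry; theorems only — no `def`, `instance`, `notation`; cube members of [Balaban1985RegularSpaces] (1.131), the genuine four-letter
`Δ_a` of `opsAllZd` at print's class `cubeLamBP`, `m ≤ k`, `d, L ≥ 2`, `L ≤ ρ`, faithful Hermitian tracial `τ`, finite-dimensional nontrivial fibre).
* `pdevOn_one` (the flat background has no plaquette deviation — the A6 witness of every «`pdevOn … U₀ < α`» hypothesis).
* ★★★ `exists_coercive_closedBall_one_cube` — ∃ `δ, c > 0`: at every unitary `U₀` with `‖U₀(b) − 1‖ ≤ δ` for all bonds `b`, `c·⟨A, A⟩_τ ≤ ⟨A, Δ_a(U₀)A⟩_τ` on `E_𝔤(□₀)`.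
* ★ `coercive_opsAllZd_gaugeAct` — `c`-coercivity passes along unitary gauge orbits, the constant UNCHANGED ((3.34)).
* ★★★★ `exists_coercive_of_pdevOn_lt_cube` — THERE ARE `α > 0` AND `c > 0` (depending on the member) SUCH THAT FOR EVERY UNITARY `U₀` WITH `‖U₀(∂p) − 1‖ < α`
  ON THE PLAQUETTES OF `□₀ ± 3`: `c·⟨A, A⟩_τ ≤ ⟨A, Δ_a(U₀)A⟩_τ` for every Hermitian `A ∈ E(□₀)`.
* ★★★ `exists_coercive_and_regularAtH_of_pdevOn_lt_cube` — the same `α` also gives dag-n06-b's `RegularAtH` (`G_𝔤(U₀) = (□₀Δ_a(U₀)□₀)⁻¹` EXISTS) and print's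
  class (1.7) of the member: exactly the pair «form bound + existence of the inverse» a Combes–Thomas step starts from.
* `coercive_one_cube` (A6: the bound at the flat background with the member's constant).

HONEST SCOPE.  (i) The constants `α, c` are MEMBER-DEPENDENT and NON-QUANTITATIVE (compactness of the unitary class × finite dimension of `E_𝔤(□₀)`); print's
Theorem 3.11 ∕ (3.115) give `M₀, α₀′` and a bound UNIFORM in the member through Thm 3.3's decay and the partition of unity — NOT proved here, NOT claimed.
(ii) No decay statement (Thm 3.3 ∕ (3.42)) is made: this file supplies the NUMBER `c` a Combes–Thomas step needs, nothing more.  (iii) `τ` is a PARAMETER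
with displayed properties; no instance.  (iv) A6: every statement is inhabited at `U₀ = 1` (`pdevOn … 1 = 0 < α`, `‖1 − 1‖ = 0 ≤ δ`).  (v) Count-neutral
helper (`--supports stmt-QuantumFields-20542`); N05 ∕ N06 NOT discharged; K1⁷ NOT closed; one finite `𝕋⁴` programme at fixed `ε`, Bałaban as printed; R4
closes only the conditional finite-`𝕋⁴` rung `BalabanLadder.UV` — nothing continuum ∕ ℝ⁴ ∕ OS ∕ mass gap ∕ Clay.  Unit `pub-ymgap-dag-n06-w4` (g4), 2026-08-28.
-/

noncomputable section

namespace Literature.MathematicalPhysics.QuantumFieldTheory.Balaban1983to89.B9Thm311CoerciveCompactZd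

open Filter Topology
open B7Prop1Explicit
open B7Prop1Local (AgreeOn PlaqIn pdevOn pdevOn_nonneg)
open B7Prop2Explicit (unitaryUnits)
open B8Ineq132 (BondTouches)
open B8Ineq130 (hol_one)
open B8Eq131Cubes (sqLo sqHi)
open B8Eq131CubesAdmissible (cubeFam)
open B8CubeMemberZd (cubeLamS)
open B8Ineq159FlatCubeMemberPrinted (cubeLamBP)
open B8LeafModelZd (ZdIdx)
open B9SupplySockB9P3ZdLetters (OpsZd deltaAOf)
open B9SupplySockB9P3ZdAllLettersZd (opsAllZd)
open B9Eq316AveragingTransposeZd (Reg17 alphaQ alphaQ_pos)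
open B9Eq316AveragingTransposeZdLevelZero (hbox0_cubeLamBP_of_eq)
open B9Eq327GreenZd (domSub bondPair)
open B9Eq327GreenZdHerm (domSubH domSubH_le RegularAtH)
open B9Eq334GaugeCovarianceZd (rotB bondPair_rotB bondPair_deltaAOf_gaugeAct letterCovAt_deltaAOf_opsAllZd)
open B9Eq334GaugeCovarianceZdHerm (rotB_mem_domSubH)
open B9Thm311PosDefOpenZd (cubeMember_Ω0_finite)
open B9Thm311PosDefOpenRegimeZd (lettersContinuousWithinAt_opsAllZd_cube_reg17UnivP)
open B9Thm311PosDefNearFlatZd (bondPair_pos_eventually_one_cube_reg17UnivP)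
open B9Eq326DeltaAHermitianZdCurved (linear_herm_on_reg17UnivP)
open B9Eq17RegimeBallZd (ball_subset_reg17UnivP exists_uniform_ball_of_eventually_reg17UnivP)
open B9Eq326DeltaALocalityZd (regular_opsAllZd_congr_cube)
open B9Thm311GaugeReductionZd (of_pdevOn_lt)
open B9Thm311PerMemberCubeZd (box3_le)
open B9Thm311PerMemberCubeZdUnconditional (regularAtH_of_pdevOn_lt_cube)
open B9Eq335UnitaryClassCompactZd (isCompact_unitary_closedBall exists_coercive_on_of_isCompact)

-- `Site` alone could resolve to the torus sites of `Setup.lean`; re-export the `ℤ^d` sites of `B7Prop1Explicit`.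
export B7Prop1Explicit (Site)

/-! ## §0  The flat background -/

section Flat

variable {d : ℕ} {𝔸 : Type*} [CStarAlgebra 𝔸]

/-- **THE FLAT BACKGROUND HAS NO PLAQUETTE DEVIATION**: `pdevOn lo hi 1 = 0` (every holonomy of `U₀ = 1` is `1`) — the A6 witness of every «`pdevOn … U₀ < α`»
hypothesis below. [cite: Balaban1985BackgroundPropagators, Thm 3.11 p.416 («G_□(1) is positive»); Balaban1985Averaging, (44) p.24] -/
theorem pdevOn_one (lo hi : Site d) : pdevOn lo hi (1 : Site d → Fin d → 𝔸ˣ) = 0 := by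
  refine le_antisymm ?_ (pdevOn_nonneg lo hi _)
  refine Real.iSup_le (fun p => ?_) le_rfl
  rw [hol_one, Units.val_one, sub_self, norm_zero]

end Flat

/-! ## §1  Cube members: ONE coercivity constant for the genuine `Δ_a` at every small field near the member -/

section Cube

variable {d : ℕ} {𝔸 : Type*} [CStarAlgebra 𝔸] [FiniteDimensional ℝ 𝔸] [Nontrivial 𝔸] {L : ℕ}
variable (τ : 𝔸 →ₗ[ℂ] ℂ) (hτp : ∀ a : 𝔸, a ≠ 0 → 0 < (τ (star a * a)).re)
  (hτt : ∀ a b : 𝔸, τ (a * b) = τ (b * a)) (hτs : ∀ a : 𝔸, τ (star a) = starRingEnd ℂ (τ a))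

include hτp hτt hτs in
/-- ★★★ **ONE COERCIVITY CONSTANT ON THE UNIFORM CLOSED BALL AROUND THE FLAT BACKGROUND**: at a cube member (`Ω = cubeFam false …`, `Λs = cubeLamS …`, class
`cubeLamBP`, `m ≤ k`, `2 ≤ d`, `2 ≤ L ≤ ρ`), faithful Hermitian tracial `τ` on a finite-dimensional fibre, there are `δ > 0` and `c > 0` such that for EVERY
unitary `U₀` with `‖U₀(b) − 1‖ ≤ δ` at every bond: `c·⟨A, A⟩_τ ≤ ⟨A, Δ_a(U₀)A⟩_τ` for every Hermitian `A ∈ E(□₀)` — positivity near `1` (this seat's g3 FILE 6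
read on dag-n06-w2's uniform ball) made UNIFORM by the compactness of that ball (§2) and the continuity of the letters within the regime (g3 FILE 7), via §3.
[cite: Balaban1985BackgroundPropagators, Thm 3.11 p.416, (3.36) p.396; Balaban1984PropagatorsII, p.226; Balaban1985RegularSpaces, (1.7) p.77, (1.131) p.99] -/
theorem exists_coercive_closedBall_one_cube (hd2 : 2 ≤ d) (hL : 2 ≤ L) (ops₀ : ℝ → ZdIdx d L → ℕ → OpsZd d 𝔸) (M : ℝ) (i : ZdIdx d L)
    {a : Site d} {Mc ρ : ℕ} (hρ : L ≤ ρ) (hΩ : i.Ω = cubeFam false L a Mc ρ i.k) (hΛs : i.Λs = cubeLamS L a Mc ρ i.k) {m : ℕ} (hm : m ≤ i.k) :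
    ∃ δ : ℝ, 0 < δ ∧ ∃ c : ℝ, 0 < c ∧ ∀ U₀ : Site d → Fin d → 𝔸ˣ, (∀ x κ, U₀ x κ ∈ unitaryUnits 𝔸) →
      (∀ x κ, ‖((U₀ x κ : 𝔸ˣ) : 𝔸) - 1‖ ≤ δ) →
        ∀ A ∈ domSubH (𝔸 := 𝔸) (i.Ω 0), c * bondPair τ A A ≤ bondPair τ A (deltaAOf i.η (opsAllZd τ L (cubeLamBP L a Mc ρ i.k) ops₀ M i m) U₀ A) := by
  haveI : NeZero L := ⟨by omega⟩
  have hL1 : 1 ≤ L := le_trans (by norm_num) hL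
  have hL0 : (0 : ℝ) < L := by exact_mod_cast (lt_of_lt_of_le zero_lt_one hL1)
  have hfin : (i.Ω 0).Finite := cubeMember_Ω0_finite i hΩ
  -- (B): positivity on a uniform open ball around `1`
  have hev := bondPair_pos_eventually_one_cube_reg17UnivP (τ := τ) (hτp := hτp) (hτt := hτt) (hτs := hτs) hd2 hL ops₀ M i hΩ hΛs hρ hm
  obtain ⟨δ₁, hδ₁, hball⟩ := exists_uniform_ball_of_eventually_reg17UnivP (𝔸 := 𝔸) hL1 m hev
  -- a radius inside both the positivity ball and the regime window
  set δ₂ : ℝ := alphaQ d L / (L : ℝ) ^ 2 * (((L : ℝ) ^ m)⁻¹) ^ 2 / 10 with hδ₂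
  have hαQ := alphaQ_pos d hL1
  have hδ₂pos : 0 < δ₂ := by rw [hδ₂]; positivity
  set δ : ℝ := min (δ₁ / 2) δ₂ with hδ
  have hδpos : 0 < δ := lt_min (by linarith) hδ₂pos
  have hδlt₁ : δ < δ₁ := lt_of_le_of_lt (min_le_left _ _) (by linarith)
  have h4δ : 4 * (min δ₁ (2 * δ₂)) < alphaQ d L / (L : ℝ) ^ 2 * (((L : ℝ) ^ m)⁻¹) ^ 2 := by
    have hq : (0 : ℝ) < alphaQ d L / (L : ℝ) ^ 2 * (((L : ℝ) ^ m)⁻¹) ^ 2 := by positivity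
    have : min δ₁ (2 * δ₂) ≤ 2 * δ₂ := min_le_right _ _
    rw [hδ₂] at this ⊢
    linarith
  -- the regime set `𝒰′` and the OPEN ball `B` between the compact class `K` and `𝒰′`
  set 𝒰 : Set (Site d → Fin d → 𝔸ˣ) := {U₀ | (∀ x κ, U₀ x κ ∈ unitaryUnits 𝔸) ∧
      Reg17 L m (fun _ => (Set.univ : Set (Site d))) (alphaQ d L / (L : ℝ) ^ 2) U₀} with h𝒰
  set K : Set (Site d → Fin d → 𝔸ˣ) := {U₀ | (∀ x κ, U₀ x κ ∈ unitaryUnits 𝔸) ∧ ∀ x κ, ‖((U₀ x κ : 𝔸ˣ) : 𝔸) - 1‖ ≤ δ} with hKdef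
  have hKball : K ⊆ {U₀ : Site d → Fin d → 𝔸ˣ | (∀ x κ, U₀ x κ ∈ unitaryUnits 𝔸) ∧ ∀ x κ, ‖((U₀ x κ : 𝔸ˣ) : 𝔸) - 1‖ < min δ₁ (2 * δ₂)} := by
    intro U hU
    refine ⟨hU.1, fun x κ => lt_of_le_of_lt (hU.2 x κ) (lt_min hδlt₁ ?_)⟩
    exact lt_of_le_of_lt (min_le_right _ _) (by linarith)
  have hK𝒰 : K ⊆ 𝒰 := fun U hU => ball_subset_reg17UnivP (𝔸 := 𝔸) hL1 m h4δ (hKball hU)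
  have hKc : IsCompact K := isCompact_unitary_closedBall δ
  have hstr := linear_herm_on_reg17UnivP τ hτt hτs hτp hL (cubeLamBP L a Mc ρ i.k) ops₀ M i m hfin
  obtain ⟨c, hc, hcoer⟩ := exists_coercive_on_of_isCompact τ hfin hK𝒰 hKc hstr.1
    (fun U₁ hU₁ => lettersContinuousWithinAt_opsAllZd_cube_reg17UnivP τ hτp hτt hτs hd2 hL (cubeLamBP L a Mc ρ i.k) ops₀ M i hΩ hΛs hρ hm (hK𝒰 hU₁))
    (fun U₀ hU₀ => hball U₀ hU₀.1 fun x κ => lt_of_le_of_lt (hU₀.2 x κ) hδlt₁)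
  exact ⟨δ, hδpos, c, hc, fun U₀ hU₀ hclose => hcoer U₀ ⟨hU₀, hclose⟩⟩

include hτp hτt hτs in
/-- ★ **`c`-COERCIVITY PASSES ALONG UNITARY GAUGE ORBITS, THE CONSTANT UNCHANGED**: if `c·⟨A, A⟩_τ ≤ ⟨A, Δ_a(U₀^u)A⟩_τ` on `E_𝔤(□₀)` then the same holds at
`U₀` (`u`, `U₀` unitary, `τ` tracial; (3.34): `⟨R(u)A, Δ_a(U₀^u)R(u)A⟩_τ = ⟨A, Δ_a(U₀)A⟩_τ` and `⟨R(u)A, R(u)A⟩_τ = ⟨A, A⟩_τ`, dag-n06-w3 g3).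
[cite: Balaban1985BackgroundPropagators, (3.34) p.396, Thm 3.11 p.416 («Doing the gauge transformation …»)] -/
theorem coercive_opsAllZd_gaugeAct (hL : 2 ≤ L) (ops₀ : ℝ → ZdIdx d L → ℕ → OpsZd d 𝔸) (M : ℝ) (i : ZdIdx d L)
    {a : Site d} {Mc ρ : ℕ} (hρ : L ≤ ρ) (hΩ : i.Ω = cubeFam false L a Mc ρ i.k) {m : ℕ} (hm : m ≤ i.k)
    {u : Site d → 𝔸ˣ} {U₀ : Site d → Fin d → 𝔸ˣ} (hu : ∀ z, u z ∈ unitaryUnits 𝔸) (hU₀ : ∀ x κ, U₀ x κ ∈ unitaryUnits 𝔸) {c : ℝ}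
    (h : ∀ A ∈ domSubH (𝔸 := 𝔸) (i.Ω 0),
      c * bondPair τ A A ≤ bondPair τ A (deltaAOf i.η (opsAllZd τ L (cubeLamBP L a Mc ρ i.k) ops₀ M i m) (gaugeAct u U₀) A)) :
    ∀ A ∈ domSubH (𝔸 := 𝔸) (i.Ω 0),
      c * bondPair τ A A ≤ bondPair τ A (deltaAOf i.η (opsAllZd τ L (cubeLamBP L a Mc ρ i.k) ops₀ M i m) U₀ A) := by
  haveI : NeZero L := ⟨by omega⟩
  have hL1 : 1 ≤ L := le_trans (by norm_num) hL
  have hfin : (i.Ω 0).Finite := cubeMember_Ω0_finite i hΩ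
  have hcov := letterCovAt_deltaAOf_opsAllZd τ L (cubeLamBP L a Mc ρ i.k) ops₀ M i m hL (hbox0_cubeLamBP_of_eq hL1 i a Mc hρ hΩ hm)
    hτt hτs hτp hU₀ hu hfin
  intro A hA
  have hA' : rotB u A ∈ domSubH (𝔸 := 𝔸) (i.Ω 0) := rotB_mem_domSubH u hu hA
  have key := bondPair_deltaAOf_gaugeAct i.η (opsAllZd τ L (cubeLamBP L a Mc ρ i.k) ops₀ M i m) τ hτt hu hcov A
  have h1 := h (rotB u A) hA'
  rw [key, bondPair_rotB u τ hτt hu] at h1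
  exact h1

include hτp hτt hτs in
/-- ★★★★ **[B9] THEOREM 3.11 ∕ [4] p. 226 IN QUANTITATIVE CURRENCY AT ONE CUBE MEMBER, FOR EVERY SMALL FIELD NEAR IT**: at a cube member of
[Balaban1985RegularSpaces] (1.131) (`Ω = cubeFam false L a Mc ρ k`, `Λs = cubeLamS …`, every truncation `m ≤ k`, `2 ≤ d`, `2 ≤ L ≤ ρ`), for print's class
`cubeLamBP` and a faithful Hermitian tracial `τ` on a finite-dimensional fibre, THERE ARE `α > 0` AND `c > 0` (depending on the member) such that for EVERY
unitary background `U₀` whose plaquette variables satisfy `‖U₀(∂p) − 1‖ < α` for the plaquettes `p` of the box `□₀ ± 3`: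
`c·⟨A, A⟩_τ ≤ ⟨A, Δ_a(U₀)A⟩_τ` for every Hermitian `A ∈ E(□₀)`, where `Δ_a(U₀) = D*D + Δ′(U₀) + D R(U₀) 𝟙 D* + Q*aQ(U₀)` is the genuine four-letter
operator of `opsAllZd`.  PROOF = dag-n06-b's schema `of_pdevOn_lt` (uniform ball ⟹ orbit ⟹ axial gauge + two cut-offs) run on the property «`c`-coercive»:
the ball by `exists_coercive_closedBall_one_cube`, the orbit by `coercive_opsAllZd_gaugeAct`, the locality by the pairing conjunct of `regular_opsAllZd_congr_cube`.
[cite: Balaban1985BackgroundPropagators, Thm 3.11 p.416, (3.27) p.395, (3.34)–(3.36) p.396; Balaban1984PropagatorsII, p.226; Balaban1985RegularSpaces, (1.7) p.77, (1.131) p.99; Balaban1985Averaging, p.24 l.-2–p.25 l.2] -/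
theorem exists_coercive_of_pdevOn_lt_cube (hd2 : 2 ≤ d) (hL : 2 ≤ L) (ops₀ : ℝ → ZdIdx d L → ℕ → OpsZd d 𝔸) (M : ℝ) (i : ZdIdx d L)
    {a : Site d} {Mc ρ : ℕ} (hρ : L ≤ ρ) (hΩ : i.Ω = cubeFam false L a Mc ρ i.k) (hΛs : i.Λs = cubeLamS L a Mc ρ i.k) {m : ℕ} (hm : m ≤ i.k) :
    ∃ α : ℝ, 0 < α ∧ ∃ c : ℝ, 0 < c ∧ ∀ U₀ : Site d → Fin d → 𝔸ˣ, (∀ x κ, U₀ x κ ∈ unitaryUnits 𝔸) →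
      pdevOn (fun i' => sqLo L a ρ i.k 0 i' - 3) (fun i' => sqHi L a Mc ρ i.k 0 i' + 3) U₀ < α →
        ∀ A ∈ domSubH (𝔸 := 𝔸) (i.Ω 0), c * bondPair τ A A ≤ bondPair τ A (deltaAOf i.η (opsAllZd τ L (cubeLamBP L a Mc ρ i.k) ops₀ M i m) U₀ A) := by
  have hfin : (i.Ω 0).Finite := cubeMember_Ω0_finite i hΩ
  obtain ⟨δ, hδ, c, hc, hball⟩ := exists_coercive_closedBall_one_cube τ hτp hτt hτs hd2 hL ops₀ M i hρ hΩ hΛs hm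
  have key := of_pdevOn_lt (P := fun U => ∀ A ∈ domSubH (𝔸 := 𝔸) (i.Ω 0),
      c * bondPair τ A A ≤ bondPair τ A (deltaAOf i.η (opsAllZd τ L (cubeLamBP L a Mc ρ i.k) ops₀ M i m) U A))
    (box3_le L a Mc ρ i.k) ⟨δ, hδ, fun U hU hclose => hball U hU fun x κ => (hclose x κ).le⟩
    (fun u U hu hU hP => coercive_opsAllZd_gaugeAct τ hτp hτt hτs hL ops₀ M i hρ hΩ hm hu hU hP)
    (fun U U' _ _ hag hP A hA => by
      rw [← (regular_opsAllZd_congr_cube τ hL ops₀ M i hρ hΩ hΛs hfin hm hag).2.2.2 A (domSubH_le _ hA)]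
      exact hP A hA)
  obtain ⟨α, hα, hαP⟩ := key
  exact ⟨α, hα, c, hc, hαP⟩

include hτp hτt hτs in
/-- ★★★ **THE READING WITH `G_𝔤(U₀)`**: one `α > 0` and one `c > 0` (member-dependent) such that every unitary `U₀` with plaquettes `α`-close to `1` on `□₀ ± 3`
is `c`-COERCIVE on `E_𝔤(□₀)`, has `Δ_a(U₀)↾□₀` INVERTIBLE on `E_𝔤(□₀)` (dag-n06-b's `RegularAtH`: `G_𝔤(U₀) = (□₀Δ_a(U₀)□₀)⁻¹` exists, (3.27)), and lies in
print's class (1.7) of the member (the `Q*aQ` letter is print's operator there) — exactly the pair «form bound `m` + existence of the inverse» a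
Combes–Thomas step starts from. [cite: Balaban1985BackgroundPropagators, Thm 3.11 p.416, (3.27) p.395, Thm 3.3 p.399; Balaban1984PropagatorsII, p.226, (2.22); Balaban1985RegularSpaces, (1.7) p.77] -/
theorem exists_coercive_and_regularAtH_of_pdevOn_lt_cube (hd2 : 2 ≤ d) (hL : 2 ≤ L) (ops₀ : ℝ → ZdIdx d L → ℕ → OpsZd d 𝔸) (M : ℝ)
    (i : ZdIdx d L) {a : Site d} {Mc ρ : ℕ} (hρ : L ≤ ρ) (hΩ : i.Ω = cubeFam false L a Mc ρ i.k) (hΛs : i.Λs = cubeLamS L a Mc ρ i.k)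
    {m : ℕ} (hm : m ≤ i.k) :
    ∃ α : ℝ, 0 < α ∧ ∃ c : ℝ, 0 < c ∧ ∀ U₀ : Site d → Fin d → 𝔸ˣ, (∀ x κ, U₀ x κ ∈ unitaryUnits 𝔸) →
      pdevOn (fun i' => sqLo L a ρ i.k 0 i' - 3) (fun i' => sqHi L a Mc ρ i.k 0 i' + 3) U₀ < α →
        (∀ A ∈ domSubH (𝔸 := 𝔸) (i.Ω 0),
            c * bondPair τ A A ≤ bondPair τ A (deltaAOf i.η (opsAllZd τ L (cubeLamBP L a Mc ρ i.k) ops₀ M i m) U₀ A)) ∧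
          RegularAtH i.η (opsAllZd τ L (cubeLamBP L a Mc ρ i.k) ops₀ M i m) (i.Ω 0) U₀ ∧
          Reg17 L m i.Ω (alphaQ d L / (L : ℝ) ^ 2) U₀ := by
  obtain ⟨α₁, hα₁, c, hc, h₁⟩ := exists_coercive_of_pdevOn_lt_cube τ hτp hτt hτs hd2 hL ops₀ M i hρ hΩ hΛs hm
  obtain ⟨α₂, hα₂, h₂⟩ := regularAtH_of_pdevOn_lt_cube τ hτp hτt hτs hd2 hL ops₀ M i hρ hΩ hΛs hm
  refine ⟨min α₁ α₂, lt_min hα₁ hα₂, c, hc, fun U₀ hU₀ hsmall => ⟨?_, ?_⟩⟩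
  · exact h₁ U₀ hU₀ (lt_of_lt_of_le hsmall (min_le_left _ _))
  · exact h₂ U₀ hU₀ (lt_of_lt_of_le hsmall (min_le_right _ _))

include hτp hτt hτs in
/-- **A6 ∕ NON-VACUITY**: the flat background `U₀ = 1` meets the hypothesis of `exists_coercive_of_pdevOn_lt_cube` at every member (`pdevOn … 1 = 0 < α`), so
the coercivity bound is a statement about an inhabited class — and it holds at `1` with the member's constant.
[cite: Balaban1985BackgroundPropagators, Thm 3.11 p.416 («G_□(1) is positive»); Balaban1984PropagatorsII, (2.11) p.225, p.226] -/
theorem coercive_one_cube (hd2 : 2 ≤ d) (hL : 2 ≤ L) (ops₀ : ℝ → ZdIdx d L → ℕ → OpsZd d 𝔸) (M : ℝ) (i : ZdIdx d L)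
    {a : Site d} {Mc ρ : ℕ} (hρ : L ≤ ρ) (hΩ : i.Ω = cubeFam false L a Mc ρ i.k) (hΛs : i.Λs = cubeLamS L a Mc ρ i.k) {m : ℕ} (hm : m ≤ i.k) :
    ∃ c : ℝ, 0 < c ∧ ∀ A ∈ domSubH (𝔸 := 𝔸) (i.Ω 0),
      c * bondPair τ A A ≤ bondPair τ A (deltaAOf i.η (opsAllZd τ L (cubeLamBP L a Mc ρ i.k) ops₀ M i m) 1 A) := by
  obtain ⟨α, hα, c, hc, h⟩ := exists_coercive_of_pdevOn_lt_cube τ hτp hτt hτs hd2 hL ops₀ M i hρ hΩ hΛs hm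
  refine ⟨c, hc, h 1 (fun _ _ => ?_) (by rw [pdevOn_one]; exact hα)⟩
  show ((1 : 𝔸ˣ) : 𝔸) ∈ unitary 𝔸
  rw [Units.val_one]
  exact one_mem _

end Cube

end Literature.MathematicalPhysics.QuantumFieldTheory.Balaban1983to89.B9Thm311CoerciveCompactZd

end
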